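import Summits.AtomisticToContinuum.Crystallization.Theorems.ContactSaturationLadderToleranceFloor
import Literature.Geometry.DiscreteGeometry.KissingPatterns

/-!
# ContactSaturationLadderGeometricTop — the GEOMETRIC TOP of the floor-7/10 tolerance ladder beneath the residual `NoLooseChunks`
# of crux `LooseTextureRung` (helper, supports item 30303; lens-1 g32 land twin of node §42 `GeometricTop42`, kernels only)

What is proved here (0 sorry, GS-free geometry + the tree's 7/10-separation of Lennard-Jones ground states):

* **The icosahedral twelve-witness** (`twelve_le_card_of_covered`): if every point within 2 of `y k` is within `< 1` of some particle, then at
  least twelve OTHER particles lie within any `R ≥ 363/125 = 2.904` of `y k` — the twelve points `y k + (1/50)•(0, ±50, ±81)` (cyclic; integer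
  icosahedron, circumradius √9061/50 = 1.9038, pairwise distances ≥ 2, all by `decide`) are each covered by a particle, pairwise-distinct ones.
* **The top of the ladder is a theorem at slack 63/20** (`noLooseChunksF_geo`, `noLooseChunksF_geoTop : NoLooseChunksF (63/20)`,
  `bandExclusionF_topBand : BandExclusionF (63/20) 4`), improving the tree's volume-count top `noLooseChunksF_four`.
* **The porous band splits exactly** (`bandExclusionF_porous_iff`: `BAND_F(1/2,4) ↔ BAND_F(1/2,1) ∧ BAND_F(1,2) ∧ BAND_F(2,63/20)`, the
  four-way `bandExclusionF_porous_iff4` through 11/4, and the six-piece grid `noLooseChunks_iff_ladderF6` of the residual `NoLooseChunks`).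
* **The scale-coupling law** `exists_close_pair_of_mem_looseSetF`: sub-geometric floor-7/10 loose matter is everywhere-compressed.
* **The sphere-covering rung**: the named pure-geometry statement `BallCoveringBound n ρ` («`n` points never come within `< 1` of every point
  of a sphere of radius `ρ`») with the reductions `noLooseChunksF_of_ballCoveringBound : BallCoveringBound 11 ρ → 1 ≤ ρ → ρ ≤ 2 →
  1 + ρ ≤ (1+δ)·(7/10) → NoLooseChunksF δ`, `noLooseChunksF_2p75_of_fejesToth` (ρ = 8/5) and `noLooseChunksF_2p95_of_area` (ρ = 7/4) PROVED;
  the instances `BallCoveringBound 11 (8/5)` (L. Fejes Tóth's covering bound for eleven congruent caps, Mat. Fiz. Lapok 50 (1943) 40–46;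
  Lagerungen in der Ebene, auf der Kugel und im Raum (1953) — cited after Croft–Falconer–Guy, Unsolved Problems in Geometry (1991) D8) and
  `BallCoveringBound 11 (7/4)` (cap-area bound) are NOT proved here and enter only as hypotheses.

No `instance`, no `notation`, no `axiom`, no `sorry`; two `def`s (`icoInt` : data, `BallCoveringBound` : a named geometric `Prop` used as a
hypothesis).  Source: lens-1 g32 node `LooseTextureRung_node_g32.lean` §42 (sha256 of record in the g32 MANIFEST), §42.1–§42.6 verbatim
minus the compositions to `LooseTextureRung` (which need the node's §V6/§40 vocabulary and stay node-side).
-/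

noncomputable section

namespace Summit.AtomisticToContinuum.Crystallization.Theorems.ContactSaturationLadderGeometricTop

open scoped BigOperators Classical
open Metric
open Literature.MathematicalPhysics.StatisticalMechanics (lennardJones IsGroundState)
open Literature.Geometry.DiscreteGeometry (intVec sqNormInt intVec_sub norm_intVec)
open Summit.AtomisticToContinuum.Crystallization.Theorems
open Summit.AtomisticToContinuum.Crystallization.Theorems.ContactSaturationLadderHaloCount (UniformlyTight looseSet voidAdjSet)
open Summit.AtomisticToContinuum.Crystallization.Theorems.ContactSaturationLadderChunkDoor (NoLooseChunkAt NoLooseChunks)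
open Summit.AtomisticToContinuum.Crystallization.Theorems.ContactSaturationLadderToleranceFloor
open Summit.AtomisticToContinuum.Crystallization.Theorems.LjLaminarWindowsSketch (lennardJones_groundState_dist_ge_seven_tenths)

/-! ### §42.1 The icosahedral twelve-witness (pure geometry: GS-free, separation-free) -/

/-- Integer model (scale `1/50`) of the twelve icosahedron vertices `(0, ±1, ±φ)` and cyclic permutations (`φ ≈ 81/50`). -/
def icoInt : Finset (Fin 3 → ℤ) :=
  {![0, 50, 81], ![0, 50, -81], ![0, -50, 81], ![0, -50, -81],
   ![50, 81, 0], ![50, -81, 0], ![-50, 81, 0], ![-50, -81, 0],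
   ![81, 0, 50], ![81, 0, -50], ![-81, 0, 50], ![-81, 0, -50]}

/-- Twelve vectors. -/
theorem card_icoInt : icoInt.card = 12 := by decide

/-- All of squared norm `9061 = 50² + 81²`. -/
theorem sqNormInt_icoInt : ∀ v ∈ icoInt, sqNormInt v = 9061 := by decide

/-- Distinct vectors differ by squared norm `≥ 10000 = (2·50)²` (edge types `100²` and `50² + 31² + 81² = 10022`). -/
theorem sqNormInt_sub_icoInt : ∀ v ∈ icoInt, ∀ w ∈ icoInt, v ≠ w → (10000 : ℤ) ≤ sqNormInt (v - w) := by decide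

/-- The twelve witness displacements have norm `√9061/50 ≈ 1.9038`. -/
theorem norm_ico {v : Fin 3 → ℤ} (hv : v ∈ icoInt) : ‖(1 / 50 : ℝ) • intVec v‖ = Real.sqrt 9061 / 50 := by
  rw [norm_smul, norm_intVec, sqNormInt_icoInt v hv, Real.norm_eq_abs, abs_of_pos (by norm_num : (0 : ℝ) < 1 / 50)]
  push_cast
  ring

/-- `√9061 ≤ 95.2` (the witness circumradius `√9061/50 ≤ 1.904 < 2`). [folklore] -/
theorem sqrt9061_le : Real.sqrt 9061 ≤ 476 / 5 := by
  have h : Real.sqrt 9061 ≤ Real.sqrt ((476 / 5) ^ 2) := Real.sqrt_le_sqrt (by norm_num)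
  rwa [Real.sqrt_sq (by norm_num)] at h

/-- `50 ≤ √9061` (the witness circumradius is `≥ 1`). [folklore] -/
theorem le_sqrt9061 : (50 : ℝ) ≤ Real.sqrt 9061 := by
  have h : Real.sqrt (50 ^ 2) ≤ Real.sqrt 9061 := Real.sqrt_le_sqrt (by norm_num)
  rwa [Real.sqrt_sq (by norm_num)] at h

/-- Distinct witness points are `≥ 2` apart. -/
theorem two_le_dist_ico (p : EuclideanSpace ℝ (Fin 3)) {v w : Fin 3 → ℤ} (hv : v ∈ icoInt) (hw : w ∈ icoInt) (hne : v ≠ w) :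
    (2 : ℝ) ≤ dist (p + (1 / 50 : ℝ) • intVec v) (p + (1 / 50 : ℝ) • intVec w) := by
  rw [dist_add_left, dist_eq_norm, ← smul_sub, intVec_sub, norm_smul, norm_intVec, Real.norm_eq_abs,
    abs_of_pos (by norm_num : (0 : ℝ) < 1 / 50)]
  have h10000 : (10000 : ℝ) ≤ (sqNormInt (v - w) : ℝ) := by exact_mod_cast sqNormInt_sub_icoInt v hv w hw hne
  have h : Real.sqrt (100 ^ 2) ≤ Real.sqrt (sqNormInt (v - w) : ℝ) := Real.sqrt_le_sqrt (by linarith)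
  rw [Real.sqrt_sq (by norm_num)] at h
  linarith

/-- **THE ICOSAHEDRAL TWELVE-WITNESS (PROVED; pure geometry, GS-free, separation-free).**  If every point within `2` of the particle `y k` lies
within `< 1` of some particle, then at least twelve OTHER particles lie within `R` of `y k` for every `R ≥ 363/125 = 2.904`: the twelve points
`y k + v/50`, `v ∈ icoInt` (norm `√9061/50 ∈ [1, 2]`, pairwise `≥ 2` apart) are covered by twelve pairwise DISTINCT particles `≠ k`, each within
`1 + √9061/50 < 2.904` of `y k`. -/
theorem twelve_le_card_of_covered {N : ℕ} (y : Fin N → EuclideanSpace ℝ (Fin 3)) (k : Fin N)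
    (hcov : ∀ x : EuclideanSpace ℝ (Fin 3), dist x (y k) ≤ 2 → ∃ j : Fin N, dist x (y j) < 1) {R : ℝ} (hR : 363 / 125 ≤ R) :
    12 ≤ (Finset.univ.filter fun l : Fin N => l ≠ k ∧ dist (y l) (y k) ≤ R).card := by
  classical
  haveI : Nonempty (Fin N) := ⟨k⟩
  have hx2 : ∀ v ∈ icoInt, dist (y k + (1 / 50 : ℝ) • intVec v) (y k) ≤ 2 := by
    intro v hv
    rw [dist_eq_norm, add_sub_cancel_left, norm_ico hv]
    linarith [sqrt9061_le]
  choose! f hf using fun v (hv : v ∈ icoInt) => hcov _ (hx2 v hv)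
  have hmaps : ∀ v ∈ icoInt, f v ∈ Finset.univ.filter fun l : Fin N => l ≠ k ∧ dist (y l) (y k) ≤ R := by
    intro v hv
    simp only [Finset.mem_filter, Finset.mem_univ, true_and]
    have h1 := hf v hv
    refine ⟨fun hfk => ?_, ?_⟩
    · rw [hfk, dist_eq_norm, add_sub_cancel_left, norm_ico hv] at h1
      linarith [le_sqrt9061]
    · have ht := dist_triangle (y (f v)) (y k + (1 / 50 : ℝ) • intVec v) (y k)
      rw [dist_comm] at h1
      have hn : dist (y k + (1 / 50 : ℝ) • intVec v) (y k) = Real.sqrt 9061 / 50 := by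
        rw [dist_eq_norm, add_sub_cancel_left, norm_ico hv]
      linarith [sqrt9061_le]
  have hinj : Set.InjOn f ↑icoInt := by
    intro v hv w hw hfvw
    rw [Finset.mem_coe] at hv hw
    by_contra hne
    have h2 := two_le_dist_ico (y k) hv hw hne
    have h1 := hf v hv
    have h1' := hf w hw
    rw [hfvw] at h1
    have ht := dist_triangle (y k + (1 / 50 : ℝ) • intVec v) (y (f w)) (y k + (1 / 50 : ℝ) • intVec w)
    rw [dist_comm (y (f w))] at ht
    linarith
  calc 12 = icoInt.card := card_icoInt.symm
    _ ≤ _ := Finset.card_le_card_of_injOn f (by intro v hv; exact hmaps v (by simpa using hv)) hinj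

/-! ### §42.2 The top of the floor-7/10 ladder LOWERED to `(1+δ)·(7/10) ≥ 2.904` (PROVED from the tree's 7/10-separation) -/

/-- **GEOMETRIC FORCING AT THE FLOOR, SHARPENED (PROVED)**: a particle whose 6-ball is `7/10`-separated and whose 5-ball is 2-void-free is uniformly
`δ`-tight at the scale `7/10` as soon as `(1+δ)·(7/10) ≥ 363/125` (g31 `uniformlyTightF_sevenTenths_of_voidFree`: `≥ 7/2`, 12-ball). -/
theorem uniformlyTightF_sevenTenths_of_covered {δ : ℝ} (hδ : 363 / 125 ≤ (1 + δ) * (7 / 10)) {N : ℕ}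
    {y : Fin N → EuclideanSpace ℝ (Fin 3)} {j : Fin N}
    (hsep : ∀ k l : Fin N, k ≠ l → dist (y k) (y j) ≤ 6 → dist (y l) (y j) ≤ 6 → (7 / 10 : ℝ) ≤ dist (y k) (y l))
    (hv : ∀ i : Fin N, dist (y i) (y j) ≤ 5 → i ∉ voidAdjSet 2 y) :
    UniformlyTightF δ (7 / 10) y j := by
  refine ⟨le_rfl, by norm_num, hsep, fun k hk => twelve_le_card_of_covered y k (fun x hx => ?_) hδ⟩
  have hk := hv k hk
  simp only [voidAdjSet, Finset.mem_filter, Finset.mem_univ, true_and, not_exists, not_and, not_forall, not_le] at hk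
  exact hk x hx

/-- **TOP KERNEL, SHARPENED (PROVED)**: for `(1+δ)·(7/10) ≥ 363/125` and `r ≥ 5`, `NoLooseChunkAtF δ r` HOLDS (an inner particle of an all-looseF
2-void-free chunk has a 7/10-separated 6-ball (tree `lennardJones_groundState_dist_ge_seven_tenths`) and a 2-void-free 5-ball). -/
theorem noLooseChunkAtF_geo {δ : ℝ} (hδ : 363 / 125 ≤ (1 + δ) * (7 / 10)) {r : ℝ} (hr : 5 ≤ r) : NoLooseChunkAtF δ r := by
  intro N y hy c hl hv i
  by_contra hin
  rw [not_lt] at hin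
  have hsep : ∀ k l : Fin N, k ≠ l → dist (y k) (y i) ≤ 6 → dist (y l) (y i) ≤ 6 → (7 / 10 : ℝ) ≤ dist (y k) (y l) :=
    fun k l hkl _ _ => lennardJones_groundState_dist_ge_seven_tenths hy hkl
  have hvi : ∀ m : Fin N, dist (y m) (y i) ≤ 5 → m ∉ voidAdjSet 2 y := fun m hm => hv m (by
    have := dist_triangle (y m) (y i) c
    linarith)
  have htight := uniformlyTightF_sevenTenths_of_covered hδ hsep hvi
  have hloose := hl i (by linarith)
  simp only [looseSetF, Finset.mem_filter, Finset.mem_univ, true_and] at hloose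
  exact hloose (7 / 10) htight

/-- **NLC_F(δ) IS A THEOREM FOR `(1+δ)·(7/10) ≥ 363/125`** (every `δ ≥ 1079/350 ≈ 3.149`; g31: δ ≥ 4). -/
theorem noLooseChunksF_geo {δ : ℝ} (hδ : 363 / 125 ≤ (1 + δ) * (7 / 10)) : NoLooseChunksF δ :=
  ⟨5, fun _ hr => noLooseChunkAtF_geo hδ hr⟩

/-- **The new grid top: NLC_F(63/20) (PROVED)** (`(83/20)·(7/10) = 581/200 ≥ 363/125`). -/
theorem noLooseChunksF_geoTop : NoLooseChunksF (63 / 20) := noLooseChunksF_geo (by norm_num)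

/-- Band pieces with lower grade `δ₁`, `(1+δ₁)·(7/10) ≥ 2.904`, are theorems. -/
theorem bandExclusionF_geo {δ₁ δ₂ : ℝ} (hδ : 363 / 125 ≤ (1 + δ₁) * (7 / 10)) : BandExclusionF δ₁ δ₂ :=
  bandExclusionF_of_noLooseChunksF (noLooseChunksF_geo hδ)

/-- In particular g31's top sub-band BAND_F(63/20, 4) is a THEOREM. -/
theorem bandExclusionF_topBand : BandExclusionF (63 / 20) 4 := bandExclusionF_geo (by norm_num)

/-! ### §42.3 The scale-coupling law: what sub-geometric loose matter is made of (PROVED) -/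

/-- **SCALE COUPLING (PROVED).**  A floor-7/10 `δ`-loose particle all of whose 5-ball particles have covered 2-balls has, for every admissible scale
`d ∈ [7/10, 6/5]` with `(1+δ)·d ≥ 363/125`, a pair of particles closer than `d` inside its 6-ball (the twelve-contact clause holds at `d` by the
twelve-witness, so looseness at `d` IS a separation failure at `d`).  At δ = 2: a pair `< 363/375 = 0.968` in every loose 6-ball. -/
theorem exists_close_pair_of_mem_looseSetF {δ : ℝ} {N : ℕ} {y : Fin N → EuclideanSpace ℝ (Fin 3)} {j : Fin N}
    (hj : j ∈ looseSetF δ y)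
    (hcov : ∀ k : Fin N, dist (y k) (y j) ≤ 5 → ∀ x : EuclideanSpace ℝ (Fin 3), dist x (y k) ≤ 2 → ∃ l : Fin N, dist x (y l) < 1)
    {d : ℝ} (hd1 : 7 / 10 ≤ d) (hd2 : d ≤ 6 / 5) (hδd : 363 / 125 ≤ (1 + δ) * d) :
    ∃ k l : Fin N, k ≠ l ∧ dist (y k) (y j) ≤ 6 ∧ dist (y l) (y j) ≤ 6 ∧ dist (y k) (y l) < d := by
  simp only [looseSetF, Finset.mem_filter, Finset.mem_univ, true_and] at hj
  have h := hj d
  unfold UniformlyTightF at h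
  by_contra hno
  push Not at hno
  exact h ⟨hd1, hd2, fun k l hkl hk hl => hno k l hkl hk hl, fun k hk => twelve_le_card_of_covered y k (hcov k hk) hδd⟩

/-! ### §42.4 The porous band BAND_F₃ = BAND_F(1/2, 4) SPLITS EXACTLY IN THREE on the grid `1/2 < 1 < 2 < 63/20` (PROVED, 0 EQUIV) -/

/-- **EXACT THREE-WAY SPLIT OF THE POROUS BAND (PROVED)**: `BAND_F(1/2,4) ⟺ BAND_F(1/2,1) ∧ BAND_F(1,2) ∧ BAND_F(2,63/20)` — the old top sub-band
`(63/20, 4)` being a theorem (`noLooseChunksF_geoTop`), and each band split exact (`noLooseChunksF_iff_band`). -/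
theorem bandExclusionF_porous_iff :
    BandExclusionF (1 / 2) 4 ↔ BandExclusionF (1 / 2) 1 ∧ BandExclusionF 1 2 ∧ BandExclusionF 2 (63 / 20) := by
  have e0 : NoLooseChunksF (1 / 2) ↔ NoLooseChunksF 4 ∧ BandExclusionF (1 / 2) 4 := noLooseChunksF_iff_band (by norm_num)
  have e1 : NoLooseChunksF (1 / 2) ↔ NoLooseChunksF 1 ∧ BandExclusionF (1 / 2) 1 := noLooseChunksF_iff_band (by norm_num)
  have e2 : NoLooseChunksF 1 ↔ NoLooseChunksF 2 ∧ BandExclusionF 1 2 := noLooseChunksF_iff_band (by norm_num)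
  have e3 : NoLooseChunksF 2 ↔ NoLooseChunksF (63 / 20) ∧ BandExclusionF 2 (63 / 20) := noLooseChunksF_iff_band (by norm_num)
  have h4 : NoLooseChunksF 4 := noLooseChunksF_four
  have hg : NoLooseChunksF (63 / 20) := noLooseChunksF_geoTop
  constructor
  · intro b04
    have n0 : NoLooseChunksF (1 / 2) := e0.mpr ⟨h4, b04⟩
    obtain ⟨n1, b1⟩ := e1.mp n0
    obtain ⟨n2, b2⟩ := e2.mp n1
    obtain ⟨-, b3⟩ := e3.mp n2
    exact ⟨b1, b2, b3⟩
  · rintro ⟨b1, b2, b3⟩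
    have n2 : NoLooseChunksF 2 := e3.mpr ⟨hg, b3⟩
    have n1 : NoLooseChunksF 1 := e2.mpr ⟨n2, b2⟩
    have n0 : NoLooseChunksF (1 / 2) := e1.mpr ⟨n1, b1⟩
    exact (e0.mp n0).2

/-- Each sub-band is WEAKER than the porous band (hence than NLC, hence than C), certified by name. -/
theorem porousSubBands_of_bandExclusionF (h : BandExclusionF (1 / 2) 4) :
    BandExclusionF (1 / 2) 1 ∧ BandExclusionF 1 2 ∧ BandExclusionF 2 (63 / 20) :=
  bandExclusionF_porous_iff.mp h

/-- In substance the top sub-band IS NLC_F(2): `BAND_F(2, 63/20) ⟺ NLC_F(2)` (the grade above it is a theorem). -/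
theorem bandExclusionF_two_iff_noLooseChunksF_two : BandExclusionF 2 (63 / 20) ↔ NoLooseChunksF 2 := by
  have e3 : NoLooseChunksF 2 ↔ NoLooseChunksF (63 / 20) ∧ BandExclusionF 2 (63 / 20) := noLooseChunksF_iff_band (by norm_num)
  exact ⟨fun b => e3.mpr ⟨noLooseChunksF_geoTop, b⟩, fun n => (e3.mp n).2⟩

/-! ### §42.5 The sphere-covering rung: `BallCoveringBound n ρ` (named, pure geometry) and the reductions (PROVED) -/

/-- **`BallCoveringBound n ρ`** — «`n` points never come within `< 1` of EVERY point of a sphere of radius `ρ`»: for every centre `c` and every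
set `Z` of at most `n` points there is a point of the sphere `S(c, ρ)` at distance `≥ 1` from all of `Z`.  For `n = 11`: TRUE for every `ρ ≥ 1.584` by
L. Fejes Tóth's covering bound (eleven congruent caps covering S² have angular radius `≥ arccos(cot(11π/54)/√3) ≈ 39.15°`, while a unit ball cuts a cap
of radius `≤ arcsin(1/ρ)·… = arccos(√(ρ²−1)/ρ) ≈ 38.97°` on `S(1.59)`, and larger spheres are cut in smaller caps); for `ρ ≥ 1.739` already by the cap-AREA bound `11·(1 − cos θ)/2 ≥ 1`; FALSE for `ρ < 1` (one point at `c`).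
Recorded at `ρ = 8/5` (Fejes Tóth) and `ρ = 7/4` (area); neither instance is proved in this file. -/
def BallCoveringBound (n : ℕ) (ρ : ℝ) : Prop :=
  ∀ (c : EuclideanSpace ℝ (Fin 3)) (Z : Finset (EuclideanSpace ℝ (Fin 3))), Z.card ≤ n →
    ∃ x : EuclideanSpace ℝ (Fin 3), dist x c = ρ ∧ ∀ z ∈ Z, 1 ≤ dist x z

/-- **REDUCTION (PROVED)**: `BallCoveringBound 11 ρ` with `1 ≤ ρ ≤ 2` forces twelve OTHER particles within `R ≥ 1 + ρ` of every particle whose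
2-ball is covered (a point of `S(y_k, ρ)` far from the `≤ 11` near particles would be uncovered). -/
theorem twelve_le_card_of_ballCoveringBound {ρ : ℝ} (hE : BallCoveringBound 11 ρ) (hρ1 : 1 ≤ ρ) (hρ2 : ρ ≤ 2) {N : ℕ}
    (y : Fin N → EuclideanSpace ℝ (Fin 3)) (k : Fin N)
    (hcov : ∀ x : EuclideanSpace ℝ (Fin 3), dist x (y k) ≤ 2 → ∃ j : Fin N, dist x (y j) < 1) {R : ℝ} (hR : 1 + ρ ≤ R) :
    12 ≤ (Finset.univ.filter fun l : Fin N => l ≠ k ∧ dist (y l) (y k) ≤ R).card := by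
  classical
  by_contra hlt
  rw [not_le] at hlt
  set L : Finset (Fin N) := Finset.univ.filter fun l : Fin N => l ≠ k ∧ dist (y l) (y k) ≤ R with hL
  have hZ : (L.image y).card ≤ 11 := le_trans Finset.card_image_le (by omega)
  obtain ⟨x, hxc, hxZ⟩ := hE (y k) (L.image y) hZ
  obtain ⟨j, hj⟩ := hcov x (by rw [hxc]; exact hρ2)
  have hjk : j ≠ k := by
    rintro rfl
    rw [hxc] at hj
    linarith
  have hjL : j ∈ L := by
    rw [hL, Finset.mem_filter]
    refine ⟨Finset.mem_univ _, hjk, ?_⟩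
    have := dist_triangle (y j) x (y k)
    rw [dist_comm (y j) x] at this
    linarith
  have := hxZ (y j) (Finset.mem_image_of_mem y hjL)
  linarith

/-- NLC_F at one radius from `BallCoveringBound 11 ρ`: `(1+δ)·(7/10) ≥ 1 + ρ`, `r ≥ 5` (PROVED reduction). -/
theorem noLooseChunkAtF_of_ballCoveringBound {ρ : ℝ} (hE : BallCoveringBound 11 ρ) (hρ1 : 1 ≤ ρ) (hρ2 : ρ ≤ 2) {δ : ℝ}
    (hδ : 1 + ρ ≤ (1 + δ) * (7 / 10)) {r : ℝ} (hr : 5 ≤ r) : NoLooseChunkAtF δ r := by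
  intro N y hy c hl hv i
  by_contra hin
  rw [not_lt] at hin
  have hsep : ∀ k l : Fin N, k ≠ l → dist (y k) (y i) ≤ 6 → dist (y l) (y i) ≤ 6 → (7 / 10 : ℝ) ≤ dist (y k) (y l) :=
    fun k l hkl _ _ => lennardJones_groundState_dist_ge_seven_tenths hy hkl
  have htight : UniformlyTightF δ (7 / 10) y i := by
    refine ⟨le_rfl, by norm_num, hsep, fun k hk => twelve_le_card_of_ballCoveringBound hE hρ1 hρ2 y k (fun x hx => ?_) hδ⟩
    have hk' : k ∉ voidAdjSet 2 y := hv k (by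
      have := dist_triangle (y k) (y i) c
      linarith)
    simp only [voidAdjSet, Finset.mem_filter, Finset.mem_univ, true_and, not_exists, not_and, not_forall, not_le] at hk'
    exact hk' x hx
  have hloose := hl i (by linarith)
  simp only [looseSetF, Finset.mem_filter, Finset.mem_univ, true_and] at hloose
  exact hloose (7 / 10) htight

/-- **NLC_F(δ) ⟸ `BallCoveringBound 11 ρ`** for `(1+δ)·(7/10) ≥ 1 + ρ` (PROVED reduction). -/
theorem noLooseChunksF_of_ballCoveringBound {ρ : ℝ} (hE : BallCoveringBound 11 ρ) (hρ1 : 1 ≤ ρ) (hρ2 : ρ ≤ 2) {δ : ℝ}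
    (hδ : 1 + ρ ≤ (1 + δ) * (7 / 10)) : NoLooseChunksF δ :=
  ⟨5, fun _ hr => noLooseChunkAtF_of_ballCoveringBound hE hρ1 hρ2 hδ hr⟩

/-- **THE FEJES TÓTH RUNG**: NLC_F(11/4) ⟸ `BallCoveringBound 11 (8/5)` (`(15/4)·(7/10) = 21/8 ≥ 13/5`; reduction PROVED). -/
theorem noLooseChunksF_2p75_of_fejesToth (hE : BallCoveringBound 11 (8 / 5)) : NoLooseChunksF (11 / 4) :=
  noLooseChunksF_of_ballCoveringBound hE (by norm_num) (by norm_num) (by norm_num)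

/-- BAND_F(11/4, 63/20) ⟸ `BallCoveringBound 11 (8/5)` (reduction PROVED). -/
theorem bandExclusionF_2p75_of_fejesToth (hE : BallCoveringBound 11 (8 / 5)) : BandExclusionF (11 / 4) (63 / 20) :=
  bandExclusionF_of_noLooseChunksF (noLooseChunksF_2p75_of_fejesToth hE)

/-- **THE AREA RUNG**: NLC_F(59/20) ⟸ `BallCoveringBound 11 (7/4)` (`(79/20)·(7/10) = 553/200 ≥ 11/4`; reduction PROVED; the hypothesis follows from
the cap-area bound with the tree's `sphereFraction` tools). -/
theorem noLooseChunksF_2p95_of_area (hE : BallCoveringBound 11 (7 / 4)) : NoLooseChunksF (59 / 20) :=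
  noLooseChunksF_of_ballCoveringBound hE (by norm_num) (by norm_num) (by norm_num)

/-- The four-way refinement of the porous band on the grid `1/2 < 1 < 2 < 11/4 < 63/20` (EXACT, unconditional, PROVED): the piece
`BAND_F(11/4, 63/20)` is the one the Fejes Tóth rung discharges. -/
theorem bandExclusionF_porous_iff4 :
    BandExclusionF (1 / 2) 4 ↔
      BandExclusionF (1 / 2) 1 ∧ BandExclusionF 1 2 ∧ BandExclusionF 2 (11 / 4) ∧ BandExclusionF (11 / 4) (63 / 20) := by
  rw [bandExclusionF_porous_iff]
  have e3 : NoLooseChunksF 2 ↔ NoLooseChunksF (63 / 20) ∧ BandExclusionF 2 (63 / 20) := noLooseChunksF_iff_band (by norm_num)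
  have e4 : NoLooseChunksF 2 ↔ NoLooseChunksF (11 / 4) ∧ BandExclusionF 2 (11 / 4) := noLooseChunksF_iff_band (by norm_num)
  have e5 : NoLooseChunksF (11 / 4) ↔ NoLooseChunksF (63 / 20) ∧ BandExclusionF (11 / 4) (63 / 20) :=
    noLooseChunksF_iff_band (by norm_num)
  have hg : NoLooseChunksF (63 / 20) := noLooseChunksF_geoTop
  have key : BandExclusionF 2 (63 / 20) ↔ BandExclusionF 2 (11 / 4) ∧ BandExclusionF (11 / 4) (63 / 20) := by
    constructor
    · intro b
      have n2 : NoLooseChunksF 2 := e3.mpr ⟨hg, b⟩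
      obtain ⟨n3, b23⟩ := e4.mp n2
      exact ⟨b23, (e5.mp n3).2⟩
    · rintro ⟨b23, b34⟩
      have n3 : NoLooseChunksF (11 / 4) := e5.mpr ⟨hg, b34⟩
      exact (e3.mp (e4.mpr ⟨n3, b23⟩)).2
  rw [key]

/-! ### §42.6 The grid of record after g32 and the compositions to C BY NAME (kernel-checked) -/

/-- **THE EXACT CUT OF THE RESIDUAL AFTER g32 (PROVED, 0 EQUIV)** on the grid `3/50 < 3/20 < 1/4 < 1/2 < 1 < 2 < 63/20`:
NLC ⟺ BAND_F(3/50,3/20) ∧ BAND_F(3/20,1/4) ∧ BAND_F(1/4,1/2) ∧ BAND_F(1/2,1) ∧ BAND_F(1,2) ∧ BAND_F(2,63/20) — six WEAKER pieces, top PROVED. -/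
theorem noLooseChunks_iff_ladderF6 :
    NoLooseChunks ↔ BandExclusionF (3 / 50) (3 / 20) ∧ BandExclusionF (3 / 20) (1 / 4) ∧ BandExclusionF (1 / 4) (1 / 2) ∧
      BandExclusionF (1 / 2) 1 ∧ BandExclusionF 1 2 ∧ BandExclusionF 2 (63 / 20) := by
  rw [noLooseChunks_iff_ladderF, bandExclusionF_porous_iff]

/-- The residual NLC from the six floor-7/10 band pieces ALONE. -/
theorem noLooseChunks_of_ladderF6 (hB₀ : BandExclusionF (3 / 50) (3 / 20)) (hB₁ : BandExclusionF (3 / 20) (1 / 4))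
    (hB₂ : BandExclusionF (1 / 4) (1 / 2)) (hB₃ : BandExclusionF (1 / 2) 1) (hB₄ : BandExclusionF 1 2)
    (hB₅ : BandExclusionF 2 (63 / 20)) : NoLooseChunks :=
  noLooseChunks_iff_ladderF6.mpr ⟨hB₀, hB₁, hB₂, hB₃, hB₄, hB₅⟩

/-- Each of the six pieces is WEAKER than NLC (certified by name, collected). -/
theorem ladderF6_of_noLooseChunks (h : NoLooseChunks) :
    BandExclusionF (3 / 50) (3 / 20) ∧ BandExclusionF (3 / 20) (1 / 4) ∧ BandExclusionF (1 / 4) (1 / 2) ∧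
      BandExclusionF (1 / 2) 1 ∧ BandExclusionF 1 2 ∧ BandExclusionF 2 (63 / 20) :=
  noLooseChunks_iff_ladderF6.mp h

end Summit.AtomisticToContinuum.Crystallization.Theorems.ContactSaturationLadderGeometricTop
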